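import Summits.RiemannHypothesis.RiemannHypothesis.Theses.LiAsymptotic
import Summits.RiemannHypothesis.RiemannHypothesis.Theorems.LiAsymptoticSmoothReplace
import Summits.RiemannHypothesis.RiemannHypothesis.Theorems.LiAsymptoticSmoothCuts
import Summits.RiemannHypothesis.RiemannHypothesis.Theorems.LiAsymptoticModelIntegral
import HarnessLib

/-!
# RiemannHypothesis / LiAsymptotic — crux K2 `LiSmoothMainTerm`: the SMOOTH MAIN TERM (RH-FREE)

RH-FREE [rh-li-prover].  Route `Theses/LiAsymptotic.lean` (rung L-P(P1⁺) «Li asymptotic law, quadratic range»,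
cell `pub/rh-li`, theory memo `theory/TARGETS.md` §11.2 STEP 6), item `LiSmoothMainTerm` (stmt-RiemannHypothesis-19162):
for `n ≥ 100` and `T' ≥ n²`,

  `|(2/π)∫_{√n}^{T'} f_n(t) ϑ'(t) dt − (liMainTerm n − 2 liCountMain √n)| ≤ liErrSmooth n = 2 log n + 1`,

`f_n = liWindowWeight n`, `ϑ' = riemannSiegelThetaDeriv`, `liMainTerm n = (n/2) log n + C₁ n`, `C₁ = (γ − 1 − log 2π)/2`.
Proof = the registered birth skeleton's composition `LiSmoothMainTerm_of_stubs` (triangle inequality,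
`1.28 + 0.64 ≤ 2`, `0.33 + 0.67 ≤ 1`) of the three landed stubs: K2a `liSmoothModelIntegral`
(`(1/π)∫_{(0,∞)}(1 − cos(n/t)) log(t/2π) = liMainTerm n`, Fubini + `J₀ = π/2`, `J₁ = (π/2)(1 − γ)`),
K2b `liSmoothReplace_bound` (replacing `ϑ'` by `½ log(t/2π)` and `θ` by `1/t`), K2c `liSmoothCuts_bound` (the two
cuts).  The closer `liSmoothMainTerm_proof` has the route decl as its type.  Nothing here bears on the truth of RH.
-/

noncomputable section

-- D-0017: `Summit.<S>.<S>.…` is the designed namespace of a single-problem summit.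
set_option linter.dupNamespace false

open MeasureTheory Set

namespace Summit.RiemannHypothesis.RiemannHypothesis.Theorems.LiTheory

open Literature.NumberTheory.LFunctions

/-- **Crux K2 `LiSmoothMainTerm`** (stmt-RiemannHypothesis-19162; RH-FREE): for `n ≥ 100`, `T' ≥ n²`,
`|(2/π)∫_{√n}^{T'} f_n ϑ' − (liMainTerm n − 2 liCountMain √n)| ≤ liErrSmooth n`.  Verbatim the route statement. -/
theorem liSmoothMainTerm_bound :
    ∀ (n : ℕ) (T' : ℝ), 100 ≤ n → (n : ℝ) ^ 2 ≤ T' →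
      |2 / Real.pi * (∫ t in Real.sqrt n..T', liWindowWeight n t * riemannSiegelThetaDeriv t) -
        (liMainTerm n - 2 * liCountMain (Real.sqrt n))| ≤ liErrSmooth n := by
  intro n T' hn hT'
  have hn1 : 1 ≤ n := le_trans (by norm_num) hn
  have h1 := liSmoothReplace_bound n T' hn hT'
  have h2 := liSmoothCuts_bound n T' hn hT'
  rw [liSmoothModelIntegral n hn1] at h2
  have hlog : 0 ≤ Real.log n := Real.log_natCast_nonneg n
  have htri := abs_sub_le
    (2 / Real.pi * (∫ t in Real.sqrt n..T', liWindowWeight n t * riemannSiegelThetaDeriv t))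
    (1 / Real.pi * (∫ t in Real.sqrt n..T', (1 - Real.cos (n / t)) * Real.log (t / (2 * Real.pi))))
    (liMainTerm n - 2 * liCountMain (Real.sqrt n))
  simp only [liErrSmooth]
  linarith

/-- **Item `LiSmoothMainTerm` of route `LiAsymptotic`** (stmt-RiemannHypothesis-19162), closed BY NAME. -/
theorem liSmoothMainTerm_proof :
    Summit.RiemannHypothesis.RiemannHypothesis.Theses.LiAsymptotic.LiSmoothMainTerm :=
  liSmoothMainTerm_bound

end Summit.RiemannHypothesis.RiemannHypothesis.Theorems.LiTheory

end
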